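import Literature.NumberTheory.Sieve.Maynard2016Lemma93AdmBox
import HarnessLib

/-!
# Maynard 2016, proof of Lemma 9.3 — the `(s,t)`-sum as a finite Euler product (displays (9.27)–(9.28))

Sources: J. Maynard, *Dense clusters of primes in subsets*, Compositio Math. 152 (2016) 1517–1554 =
arXiv:1405.2593 [Maynard2016DenseClusters], proof of Lemma 9.3, p. 24 (displays (9.26)–(9.28));
K. Ford, B. Green, S. Konyagin, J. Maynard, T. Tao, *Long gaps between primes*, JAMS 31 (2018)
[FordGreenKonyaginMaynardTao2018], §7 (7.5), (7.8) and Theorem 6 (7.13).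

Continuation of `Maynard2016Lemma93AdmBox`: after (9.25) (`FGKMT2018.yVarM_eq_sum_admBox`) and the
substitution `y_e ≈ y_{r'}` (`r' = r` with `r_m ↦ e_m`), the `e`-sum with `e_m` fixed is, in the variables
`q_j = e_j / r'_j`, a sum over `FGKMT2018.qBox` of a weight multiplicative under prime insertion, and
(9.27) evaluates it as a product over the primes («by multiplicativity»). This file supplies, exactly and
sorry-free:

* the iteration of the one-prime step `FGKMT2018.sum_qBox_mul_prime` to a square-free modulus:
  `∑_{q ∈ qBox(N)} w(q) = w(1) · ∏_{p ∣ N} (1 + [p ∤ WB·M] ∑_{j ∈ admIdx(p)∖{m}} w_p(j))`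
  (`qBox_one`, `sum_qBox_prod_eq`, `sum_qBox_eq_prod_primeFactors`);
* the re-indexing `e = r' ⊙ q` of the `e`-sum with `e_m` fixed (`sum_filter_admBoxN_eq_sum_qBox`) and the
  fibration of the `e`-sum of (9.25) by the value `c = e_m` (`sum_filter_dvd_admBoxN_eq_sum_divisors`);
* the concrete weight of (9.25)–(9.27): `sigmaM L m q = ∏_j ∏_{p ∣ q_j} S'^{(m)}_p(j)` with
  `sPrimeProdM L m r e = sigmaM L m (e/r)` (`sPrimeProdM_eq_sigmaM`), its value on `r' ⊙ q`
  (`sPrimeProdM_mul_eq_sigmaM`), and the multiplicativity of `σ` and of `σ/φ_ω` under inserting a prime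
  (`sigmaM_update_mul`, `phiOmega_prod_update_mul`, `sigmaM_div_phiOmega_update_mul`) — the hypothesis
  `hw` of the Euler-product lemmas for this weight, with local weight `w_p(j) = S'^{(m)}_p(j)/(p − ω(p))`.

## References
* J. Maynard, *Dense clusters of primes in subsets*, Compositio Math. 152 (2016), proof of Lemma 9.3
  p. 24, (9.26)–(9.28) [Maynard2016DenseClusters].
* K. Ford, B. Green, S. Konyagin, J. Maynard, T. Tao, *Long gaps between primes*, JAMS 31 (2018), §7 (7.5),
  (7.8), Thm 6 (7.13) [FordGreenKonyaginMaynardTao2018].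
-/

noncomputable section

open Finset
open scoped Nat

namespace Literature.NumberTheory.Sieve

namespace FGKMT2018

variable {k : ℕ}

/-! ### The full Euler product over a square-free modulus -/

/-- The local factor of the Euler product at `p`: `1 + [p ∤ WB, p ∤ M] ∑_{j ∈ admIdx(p) ∖ {m}} w_p(j)`.
[cite: Maynard2016DenseClusters, proof of Lemma 9.3 p. 24, (9.27)] -/
def eulerFactorM (L : Fin k → ℤ × ℤ) (B : ℕ) (m : Fin k) (M : ℕ) (wloc : ℕ → Fin k → ℝ) (p : ℕ) : ℝ :=
  1 + if p.Coprime (wCut k B * B) ∧ ¬ p ∣ M then ∑ j ∈ (admIdx L p).erase m, wloc p j else 0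

/-- `admBoxN` for the trivial modulus is `{1}`. [cite: Maynard2016DenseClusters, proof of Lemma 9.3 p. 24] -/
theorem admBoxN_one (L : Fin k → ℤ × ℤ) (B : ℕ) : admBoxN L B 1 = {fun _ => 1} := by
  classical
  ext q
  rw [mem_admBoxN_iff one_ne_zero, Finset.mem_singleton]
  constructor
  · rintro ⟨h1, -, -, -⟩
    funext i
    exact Nat.dvd_one.1 (h1 i)
  · rintro rfl
    refine ⟨fun _ => dvd_rfl, ?_, ?_, fun j p hp => ?_⟩
    · rw [Finset.prod_const_one]; exact squarefree_one
    · rw [Finset.prod_const_one]; exact Nat.coprime_one_left _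
    · simp only [Nat.primeFactors_one, Finset.notMem_empty] at hp

/-- `qBox` for the trivial modulus is `{1}`. [cite: Maynard2016DenseClusters, proof of Lemma 9.3 p. 24] -/
theorem qBox_one (L : Fin k → ℤ × ℤ) (B : ℕ) (m : Fin k) (M : ℕ) : qBox L B 1 m M = {fun _ => 1} := by
  classical
  ext q
  rw [mem_qBox_iff, admBoxN_one, Finset.mem_singleton]
  constructor
  · exact fun h => h.1
  · rintro rfl
    refine ⟨rfl, rfl, ?_⟩
    rw [Finset.prod_const_one]; exact Nat.coprime_one_left _

/-- **The Euler product over a finite set of primes**: for `w` multiplicative under prime insertion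
(`w(q·p@j) = w(q)·w_p(j)` whenever `p ∤ ∏ qᵢ`, all `qᵢ ≥ 1`),
`∑_{q ∈ qBox(∏_{p ∈ s} p)} w(q) = w(1) · ∏_{p ∈ s} (1 + [p ∤ WB·M] ∑_{j ∈ admIdx(p)∖{m}} w_p(j))`.
[cite: Maynard2016DenseClusters, proof of Lemma 9.3 p. 24, (9.27) («by multiplicativity … we can rewrite as a product»)] -/
theorem sum_qBox_prod_eq {L : Fin k → ℤ × ℤ} {B : ℕ} (s : Finset ℕ) (hs : ∀ p ∈ s, p.Prime)
    (m : Fin k) (M : ℕ) (w : (Fin k → ℕ) → ℝ) (wloc : ℕ → Fin k → ℝ)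
    (hw : ∀ p ∈ s, ∀ q : Fin k → ℕ, (∀ i, 1 ≤ q i) → ¬ p ∣ ∏ i, q i →
      ∀ j, w (Function.update q j (q j * p)) = w q * wloc p j) :
    ∑ q ∈ qBox L B (∏ p ∈ s, p) m M, w q = w (fun _ => 1) * ∏ p ∈ s, eulerFactorM L B m M wloc p := by
  classical
  induction s using Finset.induction_on with
  | empty => rw [Finset.prod_empty, Finset.prod_empty, qBox_one, Finset.sum_singleton, mul_one]
  | insert a s ha ih =>
    have hap : a.Prime := hs a (Finset.mem_insert_self a s)
    have hs' : ∀ p ∈ s, p.Prime := fun p hp => hs p (Finset.mem_insert_of_mem hp)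
    have hN : (∏ p ∈ s, p) ≠ 0 := Finset.prod_ne_zero_iff.2 fun p hp => (hs' p hp).ne_zero
    have haN : ¬ a ∣ ∏ p ∈ s, p := by
      intro h
      obtain ⟨p, hp, hap'⟩ := (Prime.dvd_finsetProd_iff hap.prime _).1 h
      exact ha (((Nat.prime_dvd_prime_iff_eq hap (hs' p hp)).1 hap') ▸ hp)
    rw [Finset.prod_insert ha, Finset.prod_insert ha, mul_comm a,
      sum_qBox_mul_prime hN hap haN m M w (wloc a) fun q hq j =>
        hw a (Finset.mem_insert_self a s) q (one_le_of_mem_admBoxN hN (mem_qBox_iff.1 hq).1)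
          (not_dvd_prod_of_mem_admBoxN hN hap haN (mem_qBox_iff.1 hq).1) j,
      ih hs' fun p hp => hw p (Finset.mem_insert_of_mem hp)]
    unfold eulerFactorM
    ring

/-- **The Euler product over a square-free modulus** (display (9.27)):
`∑_{q ∈ qBox(N)} w(q) = w(1) · ∏_{p ∣ N} (1 + [p ∤ WB·M] ∑_{j ∈ admIdx(p)∖{m}} w_p(j))`.
[cite: Maynard2016DenseClusters, proof of Lemma 9.3 p. 24, (9.27)–(9.28)] -/
theorem sum_qBox_eq_prod_primeFactors {L : Fin k → ℤ × ℤ} {B N : ℕ} (hN : Squarefree N)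
    (m : Fin k) (M : ℕ) (w : (Fin k → ℕ) → ℝ) (wloc : ℕ → Fin k → ℝ)
    (hw : ∀ p ∈ N.primeFactors, ∀ q : Fin k → ℕ, (∀ i, 1 ≤ q i) → ¬ p ∣ ∏ i, q i →
      ∀ j, w (Function.update q j (q j * p)) = w q * wloc p j) :
    ∑ q ∈ qBox L B N m M, w q = w (fun _ => 1) * ∏ p ∈ N.primeFactors, eulerFactorM L B m M wloc p := by
  rw [← sum_qBox_prod_eq N.primeFactors (fun p hp => Nat.prime_of_mem_primeFactors hp) m M w wloc hw,
    Nat.prod_primeFactors_of_squarefree hN]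

/-! ### Re-indexing `e = r' ⊙ q` and the fibration by `e_m` -/

/-- **Re-indexing**: for `r' ∈ admBoxN N`, the `e ∈ admBoxN N` with `r' ∣ e` and `e_m = r'_m` are exactly
`e = r' ⊙ q`, `q ∈ qBox N m (∏ r'ᵢ)`.
[cite: Maynard2016DenseClusters, proof of Lemma 9.3 p. 24, (9.26) («e_j = r_j s_j t_j»)] -/
theorem sum_filter_admBoxN_eq_sum_qBox {L : Fin k → ℤ × ℤ} {B N : ℕ} (hN : N ≠ 0) {r' : Fin k → ℕ}
    (hr' : r' ∈ admBoxN L B N) (m : Fin k) (f : (Fin k → ℕ) → ℝ) :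
    ∑ e ∈ (admBoxN L B N).filter (fun e => (∀ i, r' i ∣ e i) ∧ e m = r' m), f e =
      ∑ q ∈ qBox L B N m (∏ i, r' i), f (fun i => r' i * q i) := by
  classical
  have hr1 : ∀ i, 1 ≤ r' i := one_le_of_mem_admBoxN hN hr'
  obtain ⟨hrdiv, hrsq, hrcop, hridx⟩ := (mem_admBoxN_iff hN).1 hr'
  refine Finset.sum_bij' (fun e _ => fun i => e i / r' i) (fun q _ => fun i => r' i * q i)
    ?_ ?_ ?_ ?_ ?_
  · intro e he
    obtain ⟨heN, hdvd, hem⟩ := Finset.mem_filter.1 he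
    have hprod : ∏ i, e i = (∏ i, r' i) * ∏ i, e i / r' i := by
      rw [← Finset.prod_mul_distrib]
      exact Finset.prod_congr rfl fun i _ => (Nat.mul_div_cancel' (hdvd i)).symm
    have hsq : Squarefree (∏ i, e i) := ((mem_admBoxN_iff hN).1 heN).2.1
    rw [hprod] at hsq
    refine mem_qBox_iff.2 ⟨mem_admBoxN_of_dvd hN heN fun i => Nat.div_dvd_of_dvd (hdvd i), ?_, ?_⟩
    · show e m / r' m = 1
      rw [hem, Nat.div_self (hr1 m)]
    · exact (Nat.squarefree_mul_iff.1 hsq).1.symm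
  · intro q hq
    obtain ⟨hqN, hqm, hqM⟩ := mem_qBox_iff.1 hq
    obtain ⟨hqdiv, hqsq, hqcop, hqidx⟩ := (mem_admBoxN_iff hN).1 hqN
    have hq1 : ∀ i, 1 ≤ q i := one_le_of_mem_admBoxN hN hqN
    have hcop : ∀ i, (r' i).Coprime (q i) := fun i =>
      (Nat.Coprime.coprime_dvd_left (Finset.dvd_prod_of_mem _ (Finset.mem_univ i))
        (Nat.Coprime.coprime_dvd_right (Finset.dvd_prod_of_mem _ (Finset.mem_univ i)) hqM)).symm
    have hprod : ∏ i, r' i * q i = (∏ i, r' i) * ∏ i, q i := Finset.prod_mul_distrib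
    refine Finset.mem_filter.2 ⟨(mem_admBoxN_iff hN).2 ⟨fun i => ?_, ?_, ?_, fun j p hp => ?_⟩,
      fun i => Dvd.intro _ rfl, ?_⟩
    · exact (hcop i).mul_dvd_of_dvd_of_dvd (hrdiv i) (hqdiv i)
    · rw [hprod]; exact Nat.squarefree_mul_iff.2 ⟨hqM.symm, hrsq, hqsq⟩
    · rw [hprod]; exact Nat.Coprime.mul_left hrcop hqcop
    · rw [Nat.primeFactors_mul (Nat.one_le_iff_ne_zero.1 (hr1 j)) (Nat.one_le_iff_ne_zero.1 (hq1 j)),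
        Finset.mem_union] at hp
      rcases hp with hp | hp
      · exact hridx j p hp
      · exact hqidx j p hp
    · show r' m * q m = r' m
      rw [hqm, mul_one]
  · intro e he
    obtain ⟨-, hdvd, -⟩ := Finset.mem_filter.1 he
    funext i
    exact Nat.mul_div_cancel' (hdvd i)
  · intro q hq
    funext i
    exact Nat.mul_div_cancel_left (q i) (hr1 i)
  · intro e he
    obtain ⟨-, hdvd, -⟩ := Finset.mem_filter.1 he
    exact congrArg f (funext fun i => (Nat.mul_div_cancel' (hdvd i)).symm)

/-- **Fibration of the `e`-sum of (9.25) by `c = e_m`**: for `r_m = 1`,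
`∑_{e ∈ admBoxN N, r ∣ e} f(e) = ∑_{c ∣ N, r' := r[m ↦ c] ∈ admBoxN N} ∑_{q ∈ qBox N m (∏ r'ᵢ)} f(r' ⊙ q)`.
[cite: Maynard2016DenseClusters, proof of Lemma 9.3 p. 24, (9.26)–(9.27)] -/
theorem sum_filter_dvd_admBoxN_eq_sum_divisors {L : Fin k → ℤ × ℤ} {B N : ℕ} (hN : N ≠ 0)
    {r : Fin k → ℕ} (m : Fin k) (hrm : r m = 1) (f : (Fin k → ℕ) → ℝ) :
    ∑ e ∈ (admBoxN L B N).filter (fun e => ∀ i, r i ∣ e i), f e =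
      ∑ c ∈ N.divisors.filter (fun c => Function.update r m c ∈ admBoxN L B N),
        ∑ q ∈ qBox L B N m (∏ i, Function.update r m c i), f (fun i => Function.update r m c i * q i) := by
  classical
  have hfib := (Finset.sum_fiberwise_of_maps_to
    (s := (admBoxN L B N).filter (fun e => ∀ i, r i ∣ e i))
    (t := N.divisors.filter (fun c => Function.update r m c ∈ admBoxN L B N))
    (g := fun e => e m) (f := f) ?_).symm
  · rw [hfib]
    refine Finset.sum_congr rfl fun c hc => ?_
    obtain ⟨-, hc'⟩ := Finset.mem_filter.1 hc
    rw [← sum_filter_admBoxN_eq_sum_qBox hN hc' m f, Finset.filter_filter]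
    refine Finset.sum_congr (Finset.filter_congr fun e _ => ?_) fun _ _ => rfl
    simp only [Function.update_self]
    constructor
    · rintro ⟨hdvd, hem⟩
      refine ⟨fun i => ?_, hem⟩
      by_cases hi : i = m
      · subst hi; rw [Function.update_self, hem]
      · rw [Function.update_of_ne hi]; exact hdvd i
    · rintro ⟨hdvd, hem⟩
      refine ⟨fun i => ?_, hem⟩
      by_cases hi : i = m
      · subst hi; rw [hrm]; exact one_dvd _
      · have := hdvd i; rwa [Function.update_of_ne hi] at this
  · intro e he
    obtain ⟨heN, hdvd⟩ := Finset.mem_filter.1 he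
    refine Finset.mem_filter.2 ⟨Nat.mem_divisors.2 ⟨((mem_admBoxN_iff hN).1 heN).1 m, hN⟩, ?_⟩
    refine mem_admBoxN_of_dvd hN heN fun i => ?_
    by_cases hi : i = m
    · subst hi; rw [Function.update_self]
    · rw [Function.update_of_ne hi]; exact hdvd i

/-! ### The concrete weight `σ/φ_ω` and its multiplicativity -/

/-- `σ^{(m)}(q) = ∏_j ∏_{p ∣ q_j} S'^{(m)}_p(j)` — the local-factor product of (9.25) as a function of the
quotient vector `q = e/r`. [cite: Maynard2016DenseClusters, proof of Lemma 9.3 pp. 23–24, (9.24)–(9.25)] -/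
def sigmaM (L : Fin k → ℤ × ℤ) (m : Fin k) (q : Fin k → ℕ) : ℝ :=
  ∏ j, ∏ p ∈ (q j).primeFactors, sPrimeM L m j p

/-- `sPrimeProdM L m r e = σ^{(m)}(e/r)`. [cite: Maynard2016DenseClusters, proof of Lemma 9.3 p. 24, (9.25)] -/
theorem sPrimeProdM_eq_sigmaM (L : Fin k → ℤ × ℤ) (m : Fin k) (r e : Fin k → ℕ) :
    sPrimeProdM L m r e = sigmaM L m (fun j => e j / r j) := rfl

/-- `S'^{(m)}_p(m) = 1`. [cite: Maynard2016DenseClusters, proof of Lemma 9.3 p. 23, (9.24)] -/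
theorem sPrimeM_self (L : Fin k → ℤ × ℤ) (m : Fin k) (p : ℕ) : sPrimeM L m m p = 1 := by
  unfold sPrimeM; rw [if_pos (Or.inl rfl)]

/-- On `e = r' ⊙ q` with `r'_m = c`, `r_m = 1`, `q_m = 1`: `σ(r, e) = σ^{(m)}(q)` (the `m`-th factor is `1`).
[cite: Maynard2016DenseClusters, proof of Lemma 9.3 p. 24, (9.25)–(9.26)] -/
theorem sPrimeProdM_mul_eq_sigmaM (L : Fin k → ℤ × ℤ) (m : Fin k) {r q : Fin k → ℕ}
    (hr : ∀ i, 1 ≤ r i) (hqm : q m = 1) (c : ℕ) :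
    sPrimeProdM L m r (fun i => Function.update r m c i * q i) = sigmaM L m q := by
  classical
  unfold sPrimeProdM sigmaM
  refine Finset.prod_congr rfl fun j _ => ?_
  by_cases hj : j = m
  · subst hj
    rw [hqm, Nat.primeFactors_one, Finset.prod_empty]
    exact Finset.prod_eq_one fun p _ => sPrimeM_self L j p
  · dsimp only
    rw [Function.update_of_ne hj, Nat.mul_div_cancel_left (q j) (hr j)]

/-- `σ^{(m)}(1) = 1`. [cite: Maynard2016DenseClusters, proof of Lemma 9.3 p. 24] -/
theorem sigmaM_one (L : Fin k → ℤ × ℤ) (m : Fin k) : sigmaM L m (fun _ => 1) = 1 := by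
  unfold sigmaM
  exact Finset.prod_eq_one fun j _ => by rw [Nat.primeFactors_one, Finset.prod_empty]

/-- Multiplicativity of `σ` under inserting a prime: `σ(q·p@j) = σ(q)·S'_p(j)` for `p ∤ q_j`, `q_j ≥ 1`.
[cite: Maynard2016DenseClusters, proof of Lemma 9.3 p. 24, (9.27) («by multiplicativity»)] -/
theorem sigmaM_update_mul (L : Fin k → ℤ × ℤ) (m : Fin k) {q : Fin k → ℕ} {j : Fin k} (hq : 1 ≤ q j)
    {p : ℕ} (hp : p.Prime) (hpq : ¬ p ∣ q j) :
    sigmaM L m (Function.update q j (q j * p)) = sigmaM L m q * sPrimeM L m j p := by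
  classical
  unfold sigmaM
  have hsplit : ∀ g : Fin k → ℝ, ∏ i, g i = g j * ∏ i ∈ Finset.univ.erase j, g i :=
    fun g => (Finset.mul_prod_erase _ g (Finset.mem_univ j)).symm
  rw [hsplit, hsplit (fun i => ∏ p ∈ (q i).primeFactors, sPrimeM L m i p), Function.update_self,
    Nat.primeFactors_mul (Nat.one_le_iff_ne_zero.1 hq) hp.ne_zero, hp.primeFactors,
    Finset.prod_union (Finset.disjoint_singleton_right.2 fun h => hpq (Nat.dvd_of_mem_primeFactors h)),
    Finset.prod_singleton]
  have hrest : ∏ i ∈ Finset.univ.erase j, ∏ p ∈ (Function.update q j (q j * p) i).primeFactors,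
      sPrimeM L m i p = ∏ i ∈ Finset.univ.erase j, ∏ p ∈ (q i).primeFactors, sPrimeM L m i p :=
    Finset.prod_congr rfl fun i hi => by rw [Function.update_of_ne (Finset.ne_of_mem_erase hi)]
  rw [hrest]
  ring

/-- `φ_ω(p) = p − ω(p)`. [cite: FordGreenKonyaginMaynardTao2018, (7.8) p. 21] -/
theorem phiOmega_prime (L : Fin k → ℤ × ℤ) {p : ℕ} (hp : p.Prime) :
    phiOmega L p = (p : ℝ) - omegaL L p := by
  unfold phiOmega; rw [hp.primeFactors, Finset.prod_singleton]

/-- `φ_ω(∏ (q·p@j)) = (p − ω(p))·φ_ω(∏ q)` for `p ∤ ∏ qᵢ`.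
[cite: FordGreenKonyaginMaynardTao2018, (7.8) p. 21 (φ_ω multiplicative)] -/
theorem phiOmega_prod_update_mul (L : Fin k → ℤ × ℤ) (q : Fin k → ℕ) (j : Fin k) {p : ℕ}
    (hp : p.Prime) (hpq : ¬ p ∣ ∏ i, q i) :
    phiOmega L (∏ i, Function.update q j (q j * p) i) = ((p : ℝ) - omegaL L p) * phiOmega L (∏ i, q i) := by
  rw [prod_update_mul, phiOmega_mul_of_coprime L ((Nat.Prime.coprime_iff_not_dvd hp).2 hpq),
    phiOmega_prime L hp]

/-- **The weight of (9.25)–(9.27) is multiplicative under prime insertion**: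
`(σ/φ_ω)(q·p@j) = (σ/φ_ω)(q) · S'_p(j)/(p − ω(p))` for `p ∤ ∏ qᵢ`, all `qᵢ ≥ 1` — hypothesis `hw` of
`sum_qBox_prod_eq` / `sum_qBox_eq_prod_primeFactors` with `w_p(j) = S'^{(m)}_p(j)/(p − ω(p))`.
[cite: Maynard2016DenseClusters, proof of Lemma 9.3 p. 24, (9.27)] -/
theorem sigmaM_div_phiOmega_update_mul (L : Fin k → ℤ × ℤ) (m : Fin k) {q : Fin k → ℕ}
    (hq : ∀ i, 1 ≤ q i) {p : ℕ} (hp : p.Prime) (hpq : ¬ p ∣ ∏ i, q i) (j : Fin k) :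
    sigmaM L m (Function.update q j (q j * p)) / phiOmega L (∏ i, Function.update q j (q j * p) i) =
      sigmaM L m q / phiOmega L (∏ i, q i) * (sPrimeM L m j p / ((p : ℝ) - omegaL L p)) := by
  have hpj : ¬ p ∣ q j := fun h => hpq (h.trans (Finset.dvd_prod_of_mem _ (Finset.mem_univ j)))
  rw [sigmaM_update_mul L m (hq j) hp hpj, phiOmega_prod_update_mul L q j hp hpq,
    mul_comm ((p : ℝ) - omegaL L p) (phiOmega L (∏ i, q i)), mul_div_mul_comm]

end FGKMT2018

end Literature.NumberTheory.Sieve
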